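import Summits.CriticalPhenomena.PercolationContinuityZ3.Theorems.PercNearOneGluingNoHeavyQuantTwoLayerHalfPointwise
import Summits.CriticalPhenomena.PercolationContinuityZ3.Theorems.PercNearOneGluingNoHeavyQuantTwoLayerHalfRows
import Summits.CriticalPhenomena.PercolationContinuityZ3.Theorems.PercNearOneGluingNoHeavyQuantTwoLayerHalfNeed
import HarnessLib

/-!
# QUANT lane R8 on trees: THEOREM A IN ITS FREE FORM — at exchange rate `u ≥ 1` the two-layer tail family `TLB u t` is closed under
# convolution, for ARBITRARY real targets and ARBITRARY nonnegative weights (no mass, no mean, no top-affordability)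

builds on p205010 (kernel theorem, internal audit signed; external expert review pending)

Support file (`--supports stmt-CriticalPhenomena-4575`), QUANT lane seat prim-quant-arm-3 (gen 168); the certificate is prim-quant-arm-2 g38's
S* (`run/shared/lean/prim/quant/prim-quant-arm-2-g38/THEOREM-A-PROOF.md`), whose abstract pointwise inequality, row data and column profile
are the landed files `…QuantTwoLayerHalfPointwise`, `…QuantTwoLayerHalfRows`, `…QuantTwoLayerHalfNeed`.  Theorems only, standard axioms, no sorries.

THE STATEMENT (`LawDec.tlb_lconv_of_half_le`, = THEOREM-A-PROOF.md verbatim).  `1/2 ≤ y < 1`, `u = y/(1−y) ≥ 1`; `ν₁`, `ν₂ : ℕ → ℝ` nonnegative, read on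
`{0..M₁}`, `{0..M₂}` (ANY masses; no support hypothesis — mass beyond `Mᵢ` only strengthens the rows); real targets `t₁`, `t₂` (ANY — not tied to, nor bounded by, a mean: `δ_a` carries every target
`≤ 2a`); the rows `u·Σ_{h ≤ c} νᵢ h ≤ Σ_{tᵢ − c ≤ h} νᵢ h` for every integer `c` with `2c < tᵢ` (the family `LawDec.TLB u tᵢ Mᵢ νᵢ` of
`…QuantTLBClosure`, written unfolded).  THEN `lconv M₁ M₂ ν₁ ν₂` has the rows at target `t₁ + t₂`: for every `k` with `2k < t₁ + t₂`,
`u·Σ_{h ≤ k} lconv ≤ Σ_{t₁+t₂−k ≤ h} lconv`.  Also at a general rate `u ≥ 1` (`tlb_lconv_of_one_le`).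
It strictly contains the mean-tied form (`q = 1`, targets = means, probability laws; prim-quant-arm-2 g38) and the form with free targets
`≤` means (prim-quant-arm-1 g42, by push-down); it is the instance `hThmA` consumed by `LawDec.gateConv_row_aboveTarget_of_thmA`
(`…QuantPhantomRowsSharp`) for the rows `k ≥ q·T_small` of the heavy node `TLBGateConvClosedHeavy`.

THE PROOF (`halfFree_integral` + the explicit data).  Direct integration of S* against `ν₁(a)ν₂(s) ≥ 0` on the grid `{0..M₁} × {0..M₂}` —
no tensor-certificate principle, hence no index bookkeeping, no `tᵢ ≤ Mᵢ`, no phantom rows: ROWS `s` carry factor 1's reflection at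
`c(s) = min(k − s, ⌈t₁/2⌉ − 1, ⌈t₁ − k + s⌉ − 1)` (active iff `s ≤ k`, `k < t₁ + s`, `0 < t₁`) and integrate (in `a`) to `(1−y)·(row c(s) of ν₁) ≥ 0`;
COLUMNS `a` carry the two-level profile `need a ·` (`1` at and below uncovered low cells, `(1−y)/y` at and below window cells, cut at the row
bound `K = k`), whose layer cake `κ_c = need a c − need a (c+1) ≥ 0` charges factor 2's reflection at `c` only where `need a c > 0`, i.e. below a
U/W-cell, i.e. on a low row `2c < t₂`; Abel summation turns `Σ_s ν₂(s)·((1−y)·need a ⌈t₂−s⌉ − y·need a s)` into `Σ_c κ_c·(1−y)·(row c of ν₂) ≥ 0`.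
The pointwise inequality row + column ≤ kernel is `halfCert_pointwise`.  `u ≥ 1` enters there only (window level `(1−y)/y ≤ 1`).
HONEST STATUS: a theorem about laws on `ℕ`; `TLBGateConvClosedHeavy` / `FarTreeRowHeavy` become theorems only through the assembly files of the
lane (prim-quant-arm-1 g42); the RATE class log\* and the honest sentence of `run/shared/lean/prim/quant/README.md` are unchanged.

* `LawDec.halfFree_integral` — the integration step for abstract row data / column profile.
* **`LawDec.tlb_lconv_of_half_le`** (floor form, `u = y/(1−y)`), **`LawDec.tlb_lconv_of_one_le`** (rate form, `1 ≤ u`),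
  `LawDec.tlb_lconv_freeThmA` (the binder `hF` of prim-quant-arm-1 g42's `gateConv_tlbRows_of_freeThmA`, ⧗ `…QuantHeavyNodeRows`).

[this work].  Nothing here is cited as a published result.  The gluing rows served [cite: KozmaNitzan2024, Conjecture 3 (p. 15)]; product measure
[cite: Grimmett1999, §1.3 p. 10].
-/

noncomputable section

open scoped Classical

namespace Summit.CriticalPhenomena.PercolationContinuityZ3.Theorems

namespace Quant

open Finset

namespace LawDec

/-! ### Bookkeeping -/

/-- a sum up to `c` of a function vanishing above `N` is an indicator sum up to `N` (as in `…QuantUniversalCertificate`). [this work] -/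
private theorem free_sum_range_succ_eq_sum_ite (f : ℕ → ℝ) (c N : ℕ) (hf : ∀ h, N < h → f h = 0) :
    ∑ h ∈ Finset.range (c + 1), f h = ∑ h ∈ Finset.range (N + 1), (if h ≤ c then f h else 0) := by
  have h1 : ∑ h ∈ Finset.range (min c N + 1), f h = ∑ h ∈ Finset.range (c + 1), f h := by
    apply Finset.sum_subset
    · intro h hh; rw [Finset.mem_range] at hh ⊢; omega
    · intro h hh hn; rw [Finset.mem_range] at hh hn; exact hf h (by omega)
  have h2 : ∑ h ∈ Finset.range (min c N + 1), (if h ≤ c then f h else 0)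
      = ∑ h ∈ Finset.range (N + 1), (if h ≤ c then f h else 0) := by
    apply Finset.sum_subset
    · intro h hh; rw [Finset.mem_range] at hh ⊢; omega
    · intro h hh hn; rw [Finset.mem_range] at hh hn; exact if_neg (by omega)
  rw [← h1, ← h2]
  exact Finset.sum_congr rfl fun h hh => by rw [Finset.mem_range] at hh; rw [if_pos (by omega)]

/-- a partial indicator sum of a nonnegative function is below its full initial sum: `Σ_{h ≤ N} [h ≤ c]·f h ≤ Σ_{h ≤ c} f h`. [this work] -/
private theorem free_sum_ite_le_sum_range_succ (f : ℕ → ℝ) (c N : ℕ) (hf : ∀ h, 0 ≤ f h) :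
    ∑ h ∈ Finset.range (N + 1), (if h ≤ c then f h else 0) ≤ ∑ h ∈ Finset.range (c + 1), f h := by
  have h2 : ∑ h ∈ Finset.range (min c N + 1), (if h ≤ c then f h else 0)
      = ∑ h ∈ Finset.range (N + 1), (if h ≤ c then f h else 0) := by
    apply Finset.sum_subset
    · intro h hh; rw [Finset.mem_range] at hh ⊢; omega
    · intro h hh hn; rw [Finset.mem_range] at hh hn; exact if_neg (by omega)
  have h3 : ∑ h ∈ Finset.range (min c N + 1), (if h ≤ c then f h else 0) = ∑ h ∈ Finset.range (min c N + 1), f h :=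
    Finset.sum_congr rfl fun h hh => by rw [Finset.mem_range] at hh; rw [if_pos (by omega)]
  rw [← h2, h3]
  exact Finset.sum_le_sum_of_subset_of_nonneg (fun h hh => by rw [Finset.mem_range] at hh ⊢; omega) (fun h _ _ => hf h)

/-- a test function against the convolution (as in `…QuantTwoLayerCertificate`): `Σ_h φ h·lconv ν₁ ν₂ h = Σ_a Σ_s φ(a+s)·ν₁ a·ν₂ s`. [this work] -/
private theorem free_sum_fun_mul_lconv (M₁ M₂ : ℕ) (μ₁ μ₂ : ℕ → ℝ) (φ : ℕ → ℝ) :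
    ∑ h ∈ Finset.range (M₁ + M₂ + 1), φ h * lconv M₁ M₂ μ₁ μ₂ h
      = ∑ a ∈ Finset.range (M₁ + 1), ∑ s ∈ Finset.range (M₂ + 1), φ (a + s) * (μ₁ a * μ₂ s) := by
  simp only [lconv, Finset.mul_sum]
  rw [Finset.sum_comm]
  refine Finset.sum_congr rfl fun a ha => ?_
  rw [Finset.sum_comm]
  refine Finset.sum_congr rfl fun s hs => ?_
  rw [Finset.mem_range] at ha hs
  have e : ∀ h : ℕ, φ h * (if a + s = h then μ₁ a * μ₂ s else 0) = if a + s = h then φ (a + s) * (μ₁ a * μ₂ s) else 0 :=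
    fun h => by split_ifs with hh <;> simp [hh]
  simp_rw [e]
  rw [Finset.sum_ite_eq (Finset.range (M₁ + M₂ + 1)) (a + s), if_pos (Finset.mem_range.2 (by omega))]

/-- an `ite`-weighted sum as a test function (as in `…QuantTwoLayerCertificate`). [this work] -/
private theorem free_sum_ite_eq_sum_indicator_mul (M : ℕ) (ν : ℕ → ℝ) (P : ℕ → Prop) [DecidablePred P] :
    ∑ h ∈ Finset.range (M + 1), (if P h then ν h else 0) = ∑ h ∈ Finset.range (M + 1), (if P h then (1 : ℝ) else 0) * ν h :=
  Finset.sum_congr rfl fun h _ => by split_ifs <;> simp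

/-! ### The integration step -/

/-- **INTEGRATION OF AN S*-SHAPED CERTIFICATE.**  Any real `y`; nonnegative weights `ν₁`, `ν₂` with the rows (in indicator form on `{0..Mᵢ}`)
`y·Σ[a ≤ c]ν₁ ≤ (1−y)·Σ[t₁ − c ≤ a]ν₁` (`2c < t₁`) and likewise for `ν₂`, `t₂`; abstract row data `(act, c)` with (H1) `2·c s < t₁` on active
rows; a column profile `need` that is nonnegative, nonincreasing in the row, vanishes above `k` and is positive only on low rows `2s < t₂`;
and the pointwise inequality row value + `(1−y)·need a ⌈t₂ − s⌉₊ − y·need a s ≤ (1−y)·[t₁+t₂−k ≤ a+s] − y·[a+s ≤ k]` at every cell.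
THEN `0 ≤ Σ_a Σ_s ν₁ a·ν₂ s·((1−y)·[t₁+t₂−k ≤ a+s] − y·[a+s ≤ k])`. [this work] -/
theorem halfFree_integral (y t₁ t₂ : ℝ) (M₁ M₂ k : ℕ) (ν₁ ν₂ : ℕ → ℝ)
    (h10 : ∀ a, 0 ≤ ν₁ a) (h20 : ∀ s, 0 ≤ ν₂ s)
    (hR1 : ∀ c : ℕ, 2 * (c : ℝ) < t₁ → y * ∑ a ∈ Finset.range (M₁ + 1), (if a ≤ c then ν₁ a else 0)
      ≤ (1 - y) * ∑ a ∈ Finset.range (M₁ + 1), (if t₁ - c ≤ (a : ℝ) then ν₁ a else 0))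
    (hR2 : ∀ c : ℕ, 2 * (c : ℝ) < t₂ → y * ∑ s ∈ Finset.range (M₂ + 1), (if s ≤ c then ν₂ s else 0)
      ≤ (1 - y) * ∑ s ∈ Finset.range (M₂ + 1), (if t₂ - c ≤ (s : ℝ) then ν₂ s else 0))
    (act : ℕ → Prop) [DecidablePred act] (c : ℕ → ℕ) (need : ℕ → ℕ → ℝ)
    (H1 : ∀ s : ℕ, act s → 2 * (c s : ℝ) < t₁)
    (N0 : ∀ a s : ℕ, 0 ≤ need a s) (Nmono : ∀ a s s₂ : ℕ, s ≤ s₂ → need a s₂ ≤ need a s)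
    (Nvan : ∀ a s : ℕ, k < s → need a s = 0) (Nlow : ∀ a s : ℕ, 0 < need a s → 2 * (s : ℝ) < t₂)
    (hpt : ∀ a s : ℕ,
      (if act s then (1 - y) * (if t₁ - c s ≤ (a : ℝ) then (1 : ℝ) else 0) - y * (if a ≤ c s then (1 : ℝ) else 0) else 0)
        + (1 - y) * need a ⌈t₂ - s⌉₊ - y * need a s
        ≤ (1 - y) * (if t₁ + t₂ - k ≤ (a : ℝ) + s then (1 : ℝ) else 0) - y * (if a + s ≤ k then (1 : ℝ) else 0)) :
    0 ≤ ∑ a ∈ Finset.range (M₁ + 1), ∑ s ∈ Finset.range (M₂ + 1), (ν₁ a * ν₂ s) *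
      ((1 - y) * (if t₁ + t₂ - k ≤ (a : ℝ) + s then (1 : ℝ) else 0) - y * (if a + s ≤ k then (1 : ℝ) else 0)) := by
  -- names for the three cell functions
  obtain ⟨R, hR⟩ : ∃ R : ℕ → ℕ → ℝ, ∀ a s, R a s =
      (if act s then (1 - y) * (if t₁ - c s ≤ (a : ℝ) then (1 : ℝ) else 0) - y * (if a ≤ c s then (1 : ℝ) else 0) else 0) :=
    ⟨fun a s => if act s then (1 - y) * (if t₁ - c s ≤ (a : ℝ) then (1 : ℝ) else 0) - y * (if a ≤ c s then (1 : ℝ) else 0) else 0,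
      fun a s => rfl⟩
  obtain ⟨K, hK⟩ : ∃ K : ℕ → ℕ → ℝ, ∀ a s, K a s =
      (1 - y) * (if t₁ + t₂ - k ≤ (a : ℝ) + s then (1 : ℝ) else 0) - y * (if a + s ≤ k then (1 : ℝ) else 0) :=
    ⟨fun a s => (1 - y) * (if t₁ + t₂ - k ≤ (a : ℝ) + s then (1 : ℝ) else 0) - y * (if a + s ≤ k then (1 : ℝ) else 0), fun a s => rfl⟩
  have hpt' : ∀ a s, R a s + ((1 - y) * need a ⌈t₂ - s⌉₊ - y * need a s) ≤ K a s := by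
    intro a s; have h := hpt a s; rw [hR, hK]; linarith
  have hgoal : ∑ a ∈ Finset.range (M₁ + 1), ∑ s ∈ Finset.range (M₂ + 1), (ν₁ a * ν₂ s) *
      ((1 - y) * (if t₁ + t₂ - k ≤ (a : ℝ) + s then (1 : ℝ) else 0) - y * (if a + s ≤ k then (1 : ℝ) else 0))
      = ∑ a ∈ Finset.range (M₁ + 1), ∑ s ∈ Finset.range (M₂ + 1), (ν₁ a * ν₂ s) * K a s :=
    Finset.sum_congr rfl fun a _ => Finset.sum_congr rfl fun s _ => by rw [hK]
  rw [hgoal]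
  -- (1) ROWS: `Σ_a ν₁ a·R a s ≥ 0` for every `s`
  have hrow : ∀ s, 0 ≤ ∑ a ∈ Finset.range (M₁ + 1), ν₁ a * R a s := by
    intro s
    by_cases hs : act s
    · have e : ∀ a, ν₁ a * R a s
          = (1 - y) * (if t₁ - c s ≤ (a : ℝ) then ν₁ a else 0) - y * (if a ≤ c s then ν₁ a else 0) := by
        intro a; rw [hR, if_pos hs]; split_ifs <;> ring
      simp_rw [e]
      rw [Finset.sum_sub_distrib, ← Finset.mul_sum, ← Finset.mul_sum]
      linarith [hR1 (c s) (H1 s hs)]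
    · refine Finset.sum_nonneg fun a _ => ?_
      rw [hR, if_neg hs, mul_zero]
  -- (2) COLUMNS: `Σ_s ν₂ s·((1−y)·need a ⌈t₂−s⌉₊ − y·need a s) ≥ 0` for every `a`, by Abel summation over the layer cake of `need a ·`
  have hcol : ∀ a, 0 ≤ ∑ s ∈ Finset.range (M₂ + 1), ν₂ s * ((1 - y) * need a ⌈t₂ - s⌉₊ - y * need a s) := by
    intro a
    -- layer cake: `need a m = Σ_{c ≤ k, m ≤ c} (need a c − need a (c+1))`
    have htel : ∀ m : ℕ, ∑ c' ∈ Finset.range (k + 1), (if m ≤ c' then need a c' - need a (c' + 1) else 0) = need a m := by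
      intro m
      by_cases hm : m ≤ k + 1
      · have hset : ∑ c' ∈ Finset.range (k + 1), (if m ≤ c' then need a c' - need a (c' + 1) else 0)
            = ∑ c' ∈ Finset.Icc m k, (need a c' - need a (c' + 1)) := by
          rw [← Finset.sum_filter]
          refine Finset.sum_congr ?_ fun _ _ => rfl
          ext c'; simp only [Finset.mem_filter, Finset.mem_range, Finset.mem_Icc]; omega
        rw [hset]
        exact sum_Icc_sub_succ_telescope (need a) k m hm (Nvan a (k + 1) (Nat.lt_succ_self _))
      · rw [Nvan a m (by omega)]
        refine Finset.sum_eq_zero fun c' hc' => ?_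
        rw [Finset.mem_range] at hc'
        rw [if_neg (by omega)]
    -- the two sums against `ν₂`, rewritten through the layer cake and swapped
    have hlow : ∑ s ∈ Finset.range (M₂ + 1), ν₂ s * need a s
        = ∑ c' ∈ Finset.range (k + 1), (need a c' - need a (c' + 1)) * ∑ s ∈ Finset.range (M₂ + 1), (if s ≤ c' then ν₂ s else 0) := by
      have e1 : ∑ s ∈ Finset.range (M₂ + 1), ν₂ s * need a s
          = ∑ s ∈ Finset.range (M₂ + 1), ∑ c' ∈ Finset.range (k + 1), ν₂ s * (if s ≤ c' then need a c' - need a (c' + 1) else 0) :=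
        Finset.sum_congr rfl fun s _ => by rw [← htel s, Finset.mul_sum]
      rw [e1, Finset.sum_comm]
      refine Finset.sum_congr rfl fun c' _ => ?_
      rw [Finset.mul_sum]
      refine Finset.sum_congr rfl fun s _ => ?_
      split_ifs <;> ring
    have hhigh : ∑ s ∈ Finset.range (M₂ + 1), ν₂ s * need a ⌈t₂ - s⌉₊
        = ∑ c' ∈ Finset.range (k + 1), (need a c' - need a (c' + 1)) *
            ∑ s ∈ Finset.range (M₂ + 1), (if t₂ - c' ≤ (s : ℝ) then ν₂ s else 0) := by
      have e1 : ∑ s ∈ Finset.range (M₂ + 1), ν₂ s * need a ⌈t₂ - s⌉₊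
          = ∑ s ∈ Finset.range (M₂ + 1), ∑ c' ∈ Finset.range (k + 1),
              ν₂ s * (if ⌈t₂ - (s : ℝ)⌉₊ ≤ c' then need a c' - need a (c' + 1) else 0) :=
        Finset.sum_congr rfl fun s _ => by rw [← htel ⌈t₂ - (s : ℝ)⌉₊, Finset.mul_sum]
      rw [e1, Finset.sum_comm]
      refine Finset.sum_congr rfl fun c' _ => ?_
      rw [Finset.mul_sum]
      refine Finset.sum_congr rfl fun s _ => ?_
      have hiff : (⌈t₂ - (s : ℝ)⌉₊ ≤ c') ↔ (t₂ - c' ≤ (s : ℝ)) := by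
        rw [Nat.ceil_le]; constructor <;> intro h <;> linarith
      by_cases h1 : ⌈t₂ - (s : ℝ)⌉₊ ≤ c'
      · rw [if_pos h1, if_pos (hiff.1 h1)]; ring
      · rw [if_neg h1, if_neg (fun h => h1 (hiff.2 h))]; ring
    have e : ∑ s ∈ Finset.range (M₂ + 1), ν₂ s * ((1 - y) * need a ⌈t₂ - s⌉₊ - y * need a s)
        = (1 - y) * ∑ s ∈ Finset.range (M₂ + 1), ν₂ s * need a ⌈t₂ - s⌉₊ - y * ∑ s ∈ Finset.range (M₂ + 1), ν₂ s * need a s := by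
      rw [Finset.mul_sum, Finset.mul_sum, ← Finset.sum_sub_distrib]
      exact Finset.sum_congr rfl fun s _ => by ring
    rw [e, hlow, hhigh, Finset.mul_sum, Finset.mul_sum, ← Finset.sum_sub_distrib]
    refine Finset.sum_nonneg fun c' _ => ?_
    have hκ : 0 ≤ need a c' - need a (c' + 1) := by linarith [Nmono a c' (c' + 1) (Nat.le_succ _)]
    rcases (N0 a c').lt_or_eq with hpos | hzero
    · -- a charged column reflection sits below a U/W-cell: low row, the hypothesis applies
      have h2 := hR2 c' (Nlow a c' hpos)
      have : (1 - y) * ((need a c' - need a (c' + 1)) * ∑ s ∈ Finset.range (M₂ + 1), (if t₂ - c' ≤ (s : ℝ) then ν₂ s else 0))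
          - y * ((need a c' - need a (c' + 1)) * ∑ s ∈ Finset.range (M₂ + 1), (if s ≤ c' then ν₂ s else 0))
          = (need a c' - need a (c' + 1)) * ((1 - y) * ∑ s ∈ Finset.range (M₂ + 1), (if t₂ - c' ≤ (s : ℝ) then ν₂ s else 0)
            - y * ∑ s ∈ Finset.range (M₂ + 1), (if s ≤ c' then ν₂ s else 0)) := by ring
      rw [this]
      exact mul_nonneg hκ (by linarith)
    · have hz : need a c' - need a (c' + 1) = 0 := by
        have := N0 a (c' + 1); have := Nmono a c' (c' + 1) (Nat.le_succ _); rw [← hzero] at *; linarith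
      rw [hz, zero_mul, zero_mul, mul_zero, mul_zero, sub_zero]
  -- (3) add up: rows + columns ≤ kernel
  have hsplit : ∑ a ∈ Finset.range (M₁ + 1), ∑ s ∈ Finset.range (M₂ + 1), (ν₁ a * ν₂ s) * (R a s + ((1 - y) * need a ⌈t₂ - s⌉₊ - y * need a s))
      = ∑ s ∈ Finset.range (M₂ + 1), ν₂ s * ∑ a ∈ Finset.range (M₁ + 1), ν₁ a * R a s
        + ∑ a ∈ Finset.range (M₁ + 1), ν₁ a * ∑ s ∈ Finset.range (M₂ + 1), ν₂ s * ((1 - y) * need a ⌈t₂ - s⌉₊ - y * need a s) := by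
    have e : ∀ a s, (ν₁ a * ν₂ s) * (R a s + ((1 - y) * need a ⌈t₂ - s⌉₊ - y * need a s))
        = ν₂ s * (ν₁ a * R a s) + ν₁ a * (ν₂ s * ((1 - y) * need a ⌈t₂ - s⌉₊ - y * need a s)) := fun a s => by ring
    simp_rw [e, Finset.sum_add_distrib]
    congr 1
    · rw [Finset.sum_comm]
      exact Finset.sum_congr rfl fun s _ => by rw [Finset.mul_sum]
    · exact Finset.sum_congr rfl fun a _ => by rw [Finset.mul_sum]
  have hRC : 0 ≤ ∑ a ∈ Finset.range (M₁ + 1), ∑ s ∈ Finset.range (M₂ + 1),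
      (ν₁ a * ν₂ s) * (R a s + ((1 - y) * need a ⌈t₂ - s⌉₊ - y * need a s)) := by
    rw [hsplit]
    exact add_nonneg (Finset.sum_nonneg fun s _ => mul_nonneg (h20 s) (hrow s))
      (Finset.sum_nonneg fun a _ => mul_nonneg (h10 a) (hcol a))
  refine le_trans hRC (Finset.sum_le_sum fun a _ => Finset.sum_le_sum fun s _ => ?_)
  exact mul_le_mul_of_nonneg_left (hpt' a s) (mul_nonneg (h10 a) (h20 s))

/-! ### Theorem A, free form -/

/-- **THEOREM A (FREE TARGETS, FREE MASSES): the two-layer tail family is closed under convolution at floor `y ≥ 1/2`.**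
`1/2 ≤ y < 1`; `ν₁`, `ν₂ ≥ 0` (read on `{0..M₁}`, `{0..M₂}` — no support, mass or mean hypothesis); real targets `t₁`, `t₂`; the rows
`(y/(1−y))·Σ_{h ≤ c} νᵢ h ≤ Σ_{h ≤ Mᵢ, tᵢ − c ≤ h} νᵢ h` for all `2c < tᵢ`.  Then for every `k` with `2k < t₁ + t₂`: `(y/(1−y))·Σ_{h ≤ k} lconv ν₁ ν₂ h ≤ Σ_{t₁+t₂−k ≤ h} lconv ν₁ ν₂ h`.
(`= TLB (y/(1−y)) t₁ M₁ ν₁ → TLB (y/(1−y)) t₂ M₂ ν₂ → TLB (y/(1−y)) (t₁+t₂) (M₁+M₂) (lconv M₁ M₂ ν₁ ν₂)`, unfolded.) [this work] -/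
theorem tlb_lconv_of_half_le {y t₁ t₂ : ℝ} {M₁ M₂ : ℕ} {ν₁ ν₂ : ℕ → ℝ} (hy : 1 / 2 ≤ y) (hy1 : y < 1)
    (h10 : ∀ h, 0 ≤ ν₁ h) (h20 : ∀ h, 0 ≤ ν₂ h)
    (hB1 : ∀ c : ℕ, 2 * (c : ℝ) < t₁ →
      y / (1 - y) * ∑ h ∈ Finset.range (c + 1), ν₁ h ≤ ∑ h ∈ Finset.range (M₁ + 1), (if t₁ - c ≤ (h : ℝ) then ν₁ h else 0))
    (hB2 : ∀ c : ℕ, 2 * (c : ℝ) < t₂ →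
      y / (1 - y) * ∑ h ∈ Finset.range (c + 1), ν₂ h ≤ ∑ h ∈ Finset.range (M₂ + 1), (if t₂ - c ≤ (h : ℝ) then ν₂ h else 0))
    (k : ℕ) (hk : 2 * (k : ℝ) < t₁ + t₂) :
    y / (1 - y) * ∑ h ∈ Finset.range (k + 1), lconv M₁ M₂ ν₁ ν₂ h
      ≤ ∑ h ∈ Finset.range (M₁ + M₂ + 1), (if t₁ + t₂ - k ≤ (h : ℝ) then lconv M₁ M₂ ν₁ ν₂ h else 0) := by
  have hy0 : 0 < y := by linarith
  have h1y : 0 < 1 - y := by linarith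
  -- the factor rows in indicator form `y·Σ[h ≤ c]ν ≤ (1−y)·Σ[t − c ≤ h]ν`
  have hR1 : ∀ c : ℕ, 2 * (c : ℝ) < t₁ → y * ∑ a ∈ Finset.range (M₁ + 1), (if a ≤ c then ν₁ a else 0)
      ≤ (1 - y) * ∑ a ∈ Finset.range (M₁ + 1), (if t₁ - c ≤ (a : ℝ) then ν₁ a else 0) := by
    intro c hc
    have h := hB1 c hc
    rw [div_mul_eq_mul_div, div_le_iff₀ h1y] at h
    nlinarith [free_sum_ite_le_sum_range_succ ν₁ c M₁ h10, hy0]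
  have hR2 : ∀ c : ℕ, 2 * (c : ℝ) < t₂ → y * ∑ s ∈ Finset.range (M₂ + 1), (if s ≤ c then ν₂ s else 0)
      ≤ (1 - y) * ∑ s ∈ Finset.range (M₂ + 1), (if t₂ - c ≤ (s : ℝ) then ν₂ s else 0) := by
    intro c hc
    have h := hB2 c hc
    rw [div_mul_eq_mul_div, div_le_iff₀ h1y] at h
    nlinarith [free_sum_ite_le_sum_range_succ ν₂ c M₂ h20, hy0]
  -- ROW DATA of S*
  let act : ℕ → Prop := fun s => s ≤ k ∧ (k : ℝ) < t₁ + s ∧ 0 < t₁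
  let c : ℕ → ℕ := fun s => min (k - s) (min (⌈t₁ / 2⌉₊ - 1) (⌈t₁ - k + s⌉₊ - 1))
  have H1 : ∀ s : ℕ, act s → 2 * (c s : ℝ) < t₁ := fun s hs => halfRows_H1 t₁ k s hs.2.2
  have H2 : ∀ s : ℕ, act s → c s + s ≤ k := fun s hs => halfRows_H2 t₁ k s hs.1
  have H3 : ∀ s : ℕ, act s → (c s : ℝ) < t₁ - k + s := fun s hs => halfRows_H3 t₁ k s hs.2.1
  have H4 : ∀ a s : ℕ, a + s ≤ k → (¬ act s ∨ c s < a) → (t₁ ≤ 2 * (a : ℝ) ∨ t₁ - k + s ≤ (a : ℝ)) :=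
    fun a s hlow hunc => halfRows_H4 t₁ k a s hlow hunc
  have Hcov : ∀ a s : ℕ, a + s ≤ k → t₂ ≤ 2 * (s : ℝ) → act s ∧ a ≤ c s :=
    fun a s hlow hhigh => halfRows_H6 t₁ t₂ k a s hk (by omega) hhigh hlow
  -- U-cells and W-cells lie on low rows `2s < t₂`, all `≤ k`
  let U : ℕ → ℕ → Prop := fun a s => a + s ≤ k ∧ (¬ act s ∨ c s < a)
  let W : ℕ → ℕ → Prop := fun a s => act s ∧ t₁ - c s ≤ (a : ℝ) ∧ k < a + s ∧ (a : ℝ) + s < t₁ + t₂ - k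
  have hUW : ∀ a s, (U a s ∨ W a s) → 2 * (s : ℝ) < t₂ ∧ s ≤ k := by
    intro a s h
    rcases h with ⟨hlow, hunc⟩ | ⟨hact, hge, _, hlt⟩
    · refine ⟨?_, by omega⟩
      by_contra hh
      obtain ⟨hact, hle⟩ := Hcov a s hlow (not_lt.1 hh)
      rcases hunc with hna | hlt'
      · exact hna hact
      · omega
    · have h2 := H2 s hact
      have h2' : (c s : ℝ) + s ≤ k := by exact_mod_cast h2
      exact ⟨by linarith, hact.1⟩
  -- COLUMN PROFILE, cut at the row bound `k`
  set r : ℝ := (1 - y) / y with hr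
  have hr0 : 0 ≤ r := div_nonneg h1y.le hy0.le
  have hr1 : r ≤ 1 := by rw [hr, div_le_one hy0]; linarith
  obtain ⟨need, hneed⟩ : ∃ need : ℕ → ℕ → ℝ, ∀ a s : ℕ, need a s =
      (if ∃ s' ∈ Finset.Icc s k, U a s' then (1 : ℝ) else if ∃ s' ∈ Finset.Icc s k, W a s' then r else 0) :=
    ⟨fun a s => if ∃ s' ∈ Finset.Icc s k, U a s' then (1 : ℝ) else if ∃ s' ∈ Finset.Icc s k, W a s' then r else 0, fun a s => rfl⟩
  have N0 : ∀ a s : ℕ, 0 ≤ need a s := fun a s => by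
    rw [hneed]; convert need_nonneg U W r k a s hr0 using 5
  have N1 : ∀ a s : ℕ, need a s ≤ 1 := fun a s => by
    rw [hneed]; convert need_le_one U W r k a s hr1 using 5
  have NU : ∀ a s : ℕ, a + s ≤ k → (¬ act s ∨ c s < a) → need a s = 1 := fun a s hlow hunc => by
    rw [hneed]; convert need_eq_one_of_U U W r k a s (hUW a s (Or.inl ⟨hlow, hunc⟩)).2 ⟨hlow, hunc⟩ using 5
  have NW : ∀ a s : ℕ, act s → t₁ - c s ≤ (a : ℝ) → k < a + s → (a : ℝ) + s < t₁ + t₂ - k → (1 - y) / y ≤ need a s :=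
    fun a s hact hge hks hlt => by
    rw [hneed]; convert need_ge_of_W U W r k a s hr1 (hUW a s (Or.inr ⟨hact, hge, hks, hlt⟩)).2 ⟨hact, hge, hks, hlt⟩ using 5
  have Npos : ∀ a s : ℕ, 0 < need a s → ∃ s'', s ≤ s'' ∧ (U a s'' ∨ W a s'') := fun a s hpos => by
    rw [hneed] at hpos; exact need_pos_witness U W r k a s (by convert hpos using 5)
  have Nmono : ∀ a s s₂ : ℕ, s ≤ s₂ → need a s₂ ≤ need a s := fun a s s₂ hss => by
    rw [hneed, hneed]; convert need_antitone U W r k a s s₂ hr0 hr1 hss using 5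
  have Nvan : ∀ a s : ℕ, k < s → need a s = 0 := fun a s hs => by
    rw [hneed]; convert need_eq_zero_of_lt U W r k a s hs using 5
  have Nlow : ∀ a s : ℕ, 0 < need a s → 2 * (s : ℝ) < t₂ := by
    intro a s hpos
    obtain ⟨s'', hss, hcell⟩ := Npos a s hpos
    have h := (hUW a s'' hcell).1
    have : (s : ℝ) ≤ s'' := by exact_mod_cast hss
    linarith
  -- POINTWISE (S*) and INTEGRATION
  have hpt : ∀ a s : ℕ,
      (if act s then (1 - y) * (if t₁ - c s ≤ (a : ℝ) then (1 : ℝ) else 0) - y * (if a ≤ c s then (1 : ℝ) else 0) else 0)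
        + (1 - y) * need a ⌈t₂ - s⌉₊ - y * need a s
        ≤ (1 - y) * (if t₁ + t₂ - k ≤ (a : ℝ) + s then (1 : ℝ) else 0) - y * (if a + s ≤ k then (1 : ℝ) else 0) :=
    fun a s => halfCert_pointwise y t₁ t₂ k a s hy hy1 hk act c H1 H2 H3 H4 need N0 N1 NU NW Npos
  have key := halfFree_integral y t₁ t₂ M₁ M₂ k ν₁ ν₂ h10 h20 hR1 hR2 act c need H1 N0 Nmono Nvan Nlow hpt
  -- back to `lconv`: both sides of the row are these double sums
  have hA : ∑ h ∈ Finset.range (k + 1), lconv M₁ M₂ ν₁ ν₂ h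
      = ∑ a ∈ Finset.range (M₁ + 1), ∑ s ∈ Finset.range (M₂ + 1), (if a + s ≤ k then (1 : ℝ) else 0) * (ν₁ a * ν₂ s) := by
    rw [free_sum_range_succ_eq_sum_ite _ k (M₁ + M₂) (fun h hh => lconv_eq_zero M₁ M₂ ν₁ ν₂ h hh),
      free_sum_ite_eq_sum_indicator_mul (M₁ + M₂) (lconv M₁ M₂ ν₁ ν₂) (fun h => h ≤ k), free_sum_fun_mul_lconv]
  have hB : ∑ h ∈ Finset.range (M₁ + M₂ + 1), (if t₁ + t₂ - k ≤ (h : ℝ) then lconv M₁ M₂ ν₁ ν₂ h else 0)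
      = ∑ a ∈ Finset.range (M₁ + 1), ∑ s ∈ Finset.range (M₂ + 1),
          (if t₁ + t₂ - k ≤ (a : ℝ) + s then (1 : ℝ) else 0) * (ν₁ a * ν₂ s) := by
    rw [free_sum_ite_eq_sum_indicator_mul (M₁ + M₂) (lconv M₁ M₂ ν₁ ν₂) (fun h => t₁ + t₂ - k ≤ (h : ℝ)), free_sum_fun_mul_lconv]
    refine Finset.sum_congr rfl fun a _ => Finset.sum_congr rfl fun s _ => ?_
    rw [Nat.cast_add]
  rw [hA, hB, div_mul_eq_mul_div, div_le_iff₀ h1y]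
  have e : (∑ a ∈ Finset.range (M₁ + 1), ∑ s ∈ Finset.range (M₂ + 1),
        (if t₁ + t₂ - k ≤ (a : ℝ) + s then (1 : ℝ) else 0) * (ν₁ a * ν₂ s)) * (1 - y)
      - y * ∑ a ∈ Finset.range (M₁ + 1), ∑ s ∈ Finset.range (M₂ + 1), (if a + s ≤ k then (1 : ℝ) else 0) * (ν₁ a * ν₂ s)
      = ∑ a ∈ Finset.range (M₁ + 1), ∑ s ∈ Finset.range (M₂ + 1), (ν₁ a * ν₂ s) *
          ((1 - y) * (if t₁ + t₂ - k ≤ (a : ℝ) + s then (1 : ℝ) else 0) - y * (if a + s ≤ k then (1 : ℝ) else 0)) := by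
    rw [Finset.sum_mul, Finset.mul_sum, ← Finset.sum_sub_distrib]
    refine Finset.sum_congr rfl fun a _ => ?_
    rw [Finset.sum_mul, Finset.mul_sum, ← Finset.sum_sub_distrib]
    exact Finset.sum_congr rfl fun s _ => by ring
  linarith [key, e]

/-- **THEOREM A at a general exchange rate `u ≥ 1`**: `TLB u t₁ M₁ ν₁ → TLB u t₂ M₂ ν₂ → TLB u (t₁+t₂) (M₁+M₂) (lconv M₁ M₂ ν₁ ν₂)` for
nonnegative weights (unfolded; `y = u/(1+u)`). [this work] -/
theorem tlb_lconv_of_one_le {u t₁ t₂ : ℝ} {M₁ M₂ : ℕ} {ν₁ ν₂ : ℕ → ℝ} (hu : 1 ≤ u)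
    (h10 : ∀ h, 0 ≤ ν₁ h) (h20 : ∀ h, 0 ≤ ν₂ h)
    (hB1 : ∀ c : ℕ, 2 * (c : ℝ) < t₁ →
      u * ∑ h ∈ Finset.range (c + 1), ν₁ h ≤ ∑ h ∈ Finset.range (M₁ + 1), (if t₁ - c ≤ (h : ℝ) then ν₁ h else 0))
    (hB2 : ∀ c : ℕ, 2 * (c : ℝ) < t₂ →
      u * ∑ h ∈ Finset.range (c + 1), ν₂ h ≤ ∑ h ∈ Finset.range (M₂ + 1), (if t₂ - c ≤ (h : ℝ) then ν₂ h else 0))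
    (k : ℕ) (hk : 2 * (k : ℝ) < t₁ + t₂) :
    u * ∑ h ∈ Finset.range (k + 1), lconv M₁ M₂ ν₁ ν₂ h
      ≤ ∑ h ∈ Finset.range (M₁ + M₂ + 1), (if t₁ + t₂ - k ≤ (h : ℝ) then lconv M₁ M₂ ν₁ ν₂ h else 0) := by
  have hu0 : 0 < 1 + u := by linarith
  have hyu : (u / (1 + u)) / (1 - u / (1 + u)) = u := by
    field_simp
    ring
  have hy : 1 / 2 ≤ u / (1 + u) := by rw [div_le_div_iff₀ (by norm_num) hu0]; linarith
  have hy1 : u / (1 + u) < 1 := by rw [div_lt_one hu0]; linarith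
  rw [← hyu] at hB1 hB2 ⊢
  exact tlb_lconv_of_half_le hy hy1 h10 h20 hB1 hB2 k hk

/-- **Theorem A in the hypothesis binder `hF` of prim-quant-arm-1 g42's `gateConv_tlbRows_of_freeThmA` (`…QuantHeavyNodeRows`)** —
probability laws, targets `0 < τᵢ ≤ mean`; all these extra hypotheses are simply dropped.  With it the heavy node is
`gateConv_tlbRows_of_freeThmA tlb_lconv_freeThmA` (by name once `…QuantTLBClosureHeavy` / `…QuantHeavyNodeRows` are in the tree). [this work] -/
theorem tlb_lconv_freeThmA : ∀ (y : ℝ) (M₁ M₂ : ℕ) (ν₁ ν₂ : ℕ → ℝ) (τ₁ τ₂ : ℝ), 1 / 2 ≤ y → y < 1 →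
    (∀ h, 0 ≤ ν₁ h) → (∑ h ∈ Finset.range (M₁ + 1), ν₁ h = 1) →
    (∀ h, 0 ≤ ν₂ h) → (∑ h ∈ Finset.range (M₂ + 1), ν₂ h = 1) →
    0 < τ₁ → τ₁ ≤ ∑ h ∈ Finset.range (M₁ + 1), (h : ℝ) * ν₁ h →
    0 < τ₂ → τ₂ ≤ ∑ h ∈ Finset.range (M₂ + 1), (h : ℝ) * ν₂ h →
    (∀ c : ℕ, 2 * (c : ℝ) < τ₁ →
      y / (1 - y) * ∑ h ∈ Finset.range (c + 1), ν₁ h ≤ ∑ h ∈ Finset.range (M₁ + 1), (if τ₁ - c ≤ (h : ℝ) then ν₁ h else 0)) →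
    (∀ c : ℕ, 2 * (c : ℝ) < τ₂ →
      y / (1 - y) * ∑ h ∈ Finset.range (c + 1), ν₂ h ≤ ∑ h ∈ Finset.range (M₂ + 1), (if τ₂ - c ≤ (h : ℝ) then ν₂ h else 0)) →
    ∀ k : ℕ, 2 * (k : ℝ) < τ₁ + τ₂ →
      y / (1 - y) * ∑ h ∈ Finset.range (k + 1), lconv M₁ M₂ ν₁ ν₂ h
        ≤ ∑ h ∈ Finset.range (M₁ + M₂ + 1), (if τ₁ + τ₂ - k ≤ (h : ℝ) then lconv M₁ M₂ ν₁ ν₂ h else 0) :=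
  fun _ _ _ _ _ _ _ hy hy1 h10 _ h20 _ _ _ _ _ hB1 hB2 k hk => tlb_lconv_of_half_le hy hy1 h10 h20 hB1 hB2 k hk

end LawDec

end Quant

end Summit.CriticalPhenomena.PercolationContinuityZ3.Theorems
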